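import Summits.Ventures.GridStability.Models.DroopQVPortHamiltonianQGains
import Summits.Ventures.GridStability.Models.WSCC9DroopQVHessian
import Summits.Ventures.GridStability.Models.NE39DroopQVHurwitz

/-!
# GridStability/Models/DroopQVGainsHurwitzInstances — Hurwitz on the rotation quotient for EVERY positive P–f gain vector: the lossless constructions «DROOPQV-WSCC9» (9 states, 3 free gains) and «DROOPQV-NE39» (30 states, 10 free gains)

Cell `gridfusion` (LADDER-GRIDFUSION, APEX LINE rung G3.b; seat gridfusion-model-8 (g4); default-work item (E) «G3.b-ss-DROOPQV-ALL-GAINS-HURWITZ»).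
Instances of `Models/DroopQVPortHamiltonianGains.lean` / `…Filters.lean` (one Hessian certificate serves every positive P–f gain vector, and every
positive triple (gains, τ_P, τ_Q) per unit, by a diagonal congruence) on the two LOSSLESS constructions whose certificates `𝒬(θ*, V*) + r rᵀ ≻ 0` are in the tree:
* `WSCC9.droopQV_gains_eig_re_neg_or_rotation`: for EVERY `κ : Fin 3 → ℝ` with all `κ_i > 0`, every complex eigenpair `(μ, v)` of the `9 × 9`
  Jacobian at `(θ*, V*)` of `WSCC9.droopQV.toMicrogrid.withKP κ` (#51's construction with the three P–f droop gains replaced by `κ`, NOT necessarily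
  uniform; rest point unchanged, `WSCC9.droopQV_gains_field_eq_zero`) has `Re μ < 0`, or `μ = 0` with `v ∈ ℂ·r`; no Jordan chain at `0`
  (`WSCC9.droopQV_gains_no_jordan_chain_at_zero`). Certificate: `WSCC9.droopQV_hessQ_add_rankOne_posDef` (p521952, one 9 × 9 integer Gram).
* `NE39.droopQV_gains_eig_re_neg_or_rotation` / `_no_jordan_chain_at_zero`: the same for EVERY `κ : Fin 10 → ℝ` with all `κ_i > 0` on the
  30-state construction `NE39.droopQV` (#68), certificate `NE39.droopQV_hessQ_add_rankOne_posDef` (p529218, shifted rounded twin).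
* `WSCC9.droopQV_loop_eig_re_neg_or_rotation` / `NE39.droopQV_loop_eig_re_neg_or_rotation`: the same for EVERY positive `(κ, τ_P′, τ_Q′)` — ALL `9` resp.
  `30` frequency-loop parameters free (model `withGainsTau`; every positive virtual inertia `τ_P′_i/κ_i` and damping of every unit).
* `WSCC9.droopQV_allLoops_eig_re_neg_or_rotation` / `NE39.…`: ALL `4n` loop parameters (`12` resp. `40`): the above plus every Q–V gain vector
  `0 < κ_Qi ≤ 1/5` (the Hessian certificate is MONOTONE in `k_Q`, `Models/DroopQVPortHamiltonianQGains.lean`).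
These are SIGN statements (no rate) over the whole positive orthant of loop parameters — complementing the RATE
statements on uniform-gain boxes / rays (`Models/WSCC9DroopQV*Gain*.lean`). THREE COLUMNS. CERTIFIED (kernel): matrix statements about the MODELS
`WSCC9.droopQV.toMicrogrid.withKP κ` / `NE39.droopQV.toMicrogrid.withKP κ`. MODELLED: MV-6N — SYNTHETIC/CONSTRUCTIONS as #51 / #68 (h12 couplings,
`G = 0`, no loads; `k_Q = 1/5`, `τ = 1/2` AS PRINTED [cite: KunduEtAl2019, §V]; the P–f gains the PARAMETERS; set-points DEFINED from the point).
VALIDATED: nothing new. Never a region of attraction, never the printed WSCC / New England systems; no sentence of this file says a grid, a microgrid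
or a converter is stable.
-/

noncomputable section

open Real Matrix Finset
open scoped ComplexOrder

namespace Summit.Ventures.GridStability.Models

namespace WSCC9

/-- The rest point of «DROOPQV-WSCC9» does not move with the P–f gains. [folklore] -/
theorem droopQV_gains_field_eq_zero (κ : Fin 3 → ℝ) :
    (droopQV.toMicrogrid.withKP κ).field (droopQV.angleOf, 0, droopQV.Vstar) = 0 :=
  droopQV.toMicrogrid.withKP_field_eq_zero κ droopQV.isSteadyState

/-- **«DROOPQV-WSCC9»: Hurwitz on the rotation quotient for EVERY positive P–f gain vector.** For every `κ : Fin 3 → ℝ` with `κ_i > 0`, every complex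
eigenpair `(μ, v)` of the `9 × 9` Jacobian `jacMatrix (θ*, V*)` of `droopQV.toMicrogrid.withKP κ` has `Re μ < 0`, or `μ = 0` with `v ∈ ℂ·r`. CERTIFIED
(the ONE Gram certificate of p521952, transported to all gains by congruence); MODELLED: MV-6N SYNTHETIC/CONSTRUCTION, lossless, gains `κ` free.
No stability sentence. [folklore] -/
theorem droopQV_gains_eig_re_neg_or_rotation (κ : Fin 3 → ℝ) (hκ : ∀ i, 0 < κ i) {μ : ℂ} {v : Fin 3 ⊕ (Fin 3 ⊕ Fin 3) → ℂ} (hv : v ≠ 0)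
    (hJ : ((droopQV.toMicrogrid.withKP κ).jacMatrix droopQV.angleOf droopQV.Vstar).map ((↑) : ℝ → ℂ) *ᵥ v = μ • v) :
    μ.re < 0 ∨ (μ = 0 ∧ ∃ a : ℂ, v = fun k => a * ((DroopMicrogrid.rot k : ℝ) : ℂ)) := by
  have hg := fun i => droopQV.toMicrogrid_gains i
  have hVq : ∀ i : Fin 3, 0 < droopQV.V i := by decide +kernel
  have hr : rotVec = DroopMicrogrid.rot := rfl
  have hP := droopQV_hessQ_add_rankOne_posDef
  rw [hr] at hP
  refine droopQV.toMicrogrid.re_eig_neg_or_rotation_of_hessQ_withKP _ _ (fun i => ?_) (fun i => ?_) (fun i => ?_) (fun i => ?_)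
    (fun i => ?_) droopQV_hessQ_transpose hP hκ hv hJ
  · rw [(hg i).2.2.1]; norm_num [droopQV]
  · rw [(hg i).1]; norm_num [droopQV]
  · rw [(hg i).2.2.2.1]; norm_num [droopQV]
  · change (droopQV.V i : ℝ) ≠ 0
    exact_mod_cast (hVq i).ne'
  · rw [(hg i).2.2.2.1, (hg i).2.1]
    have := hVq i
    simp only [DroopQVData.Vstar]
    norm_num [droopQV]
    positivity

/-- **SIMPLE rotation zero for every positive gain vector** («DROOPQV-WSCC9»): no complex `w` with `jacMatrix (θ*, V*) w = r` for
`droopQV.toMicrogrid.withKP κ`. CERTIFIED (structural); MODELLED as above. No stability sentence. [folklore] -/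
theorem droopQV_gains_no_jordan_chain_at_zero (κ : Fin 3 → ℝ) (hκ : ∀ i, 0 < κ i) {w : Fin 3 ⊕ (Fin 3 ⊕ Fin 3) → ℂ}
    (hw : ((droopQV.toMicrogrid.withKP κ).jacMatrix droopQV.angleOf droopQV.Vstar).map ((↑) : ℝ → ℂ) *ᵥ w
      = fun k => ((DroopMicrogrid.rot k : ℝ) : ℂ)) : False := by
  have hg := fun i => droopQV.toMicrogrid_gains i
  have hVq : ∀ i : Fin 3, 0 < droopQV.V i := by decide +kernel
  refine droopQV.toMicrogrid.no_jordan_chain_at_zero_of_hessQ_withKP _ _ (fun i => ?_) (fun i => ?_) (fun i => ?_) (fun i => ?_)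
    (fun i => ?_) droopQV_hessQ_transpose 0 hκ hw
  · rw [(hg i).2.2.1]; norm_num [droopQV]
  · rw [(hg i).1]; norm_num [droopQV]
  · rw [(hg i).2.2.2.1]; norm_num [droopQV]
  · change (droopQV.V i : ℝ) ≠ 0
    exact_mod_cast (hVq i).ne'
  · rw [(hg i).2.2.2.1, (hg i).2.1]
    have := hVq i
    simp only [DroopQVData.Vstar]
    norm_num [droopQV]
    positivity

/-- **«DROOPQV-WSCC9»: Hurwitz on the rotation quotient for EVERY positive frequency-loop parameter set** — P–f gains `κ`, filter constants `τ_P′`, `τ_Q′`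
of the three units all free and positive (`9` parameters; model `withGainsTau`). CERTIFIED (p521952's certificate by congruence); MODELLED: MV-6N
SYNTHETIC/CONSTRUCTION, lossless. No stability sentence. [folklore] -/
theorem droopQV_loop_eig_re_neg_or_rotation (κ τP' τQ' : Fin 3 → ℝ) (hκ : ∀ i, 0 < κ i) (hτP' : ∀ i, 0 < τP' i) (hτQ' : ∀ i, 0 < τQ' i)
    {μ : ℂ} {v : Fin 3 ⊕ (Fin 3 ⊕ Fin 3) → ℂ} (hv : v ≠ 0)
    (hJ : ((droopQV.toMicrogrid.withGainsTau κ τP' τQ').jacMatrix droopQV.angleOf droopQV.Vstar).map ((↑) : ℝ → ℂ) *ᵥ v = μ • v) :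
    μ.re < 0 ∨ (μ = 0 ∧ ∃ a : ℂ, v = fun k => a * ((DroopMicrogrid.rot k : ℝ) : ℂ)) := by
  have hg := fun i => droopQV.toMicrogrid_gains i
  have hVq : ∀ i : Fin 3, 0 < droopQV.V i := by decide +kernel
  have hr : rotVec = DroopMicrogrid.rot := rfl
  have hP := droopQV_hessQ_add_rankOne_posDef
  rw [hr] at hP
  refine droopQV.toMicrogrid.re_eig_neg_or_rotation_of_hessQ_withGainsTau _ _ (fun i => ?_) (fun i => ?_) (fun i => ?_) (fun i => ?_)
    (fun i => ?_) droopQV_hessQ_transpose hP hκ hτP' hτQ' hv hJ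
  · rw [(hg i).2.2.1]; norm_num [droopQV]
  · rw [(hg i).1]; norm_num [droopQV]
  · rw [(hg i).2.2.2.1]; norm_num [droopQV]
  · change (droopQV.V i : ℝ) ≠ 0
    exact_mod_cast (hVq i).ne'
  · rw [(hg i).2.2.2.1]
    have := hVq i
    simp only [DroopQVData.Vstar]
    norm_num [droopQV]
    positivity

/-- The rest point of «DROOPQV-WSCC9» does not move with the loop parameters. [folklore] -/
theorem droopQV_loop_field_eq_zero (κ τP' τQ' : Fin 3 → ℝ) :
    (droopQV.toMicrogrid.withGainsTau κ τP' τQ').field (droopQV.angleOf, 0, droopQV.Vstar) = 0 :=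
  droopQV.toMicrogrid.withGainsTau_field_eq_zero κ τP' τQ' droopQV.isSteadyState

/-- **«DROOPQV-WSCC9»: ALL `12` loop parameters.** For every positive `κ, τ_P′, τ_Q′` and every `κ_Q` with `0 < κ_Qi ≤ 1/5` (the printed Q–V gain), every complex
eigenpair of the `9 × 9` Jacobian at `(θ*, V*)` of `(droopQV.toMicrogrid.withGainsTau κ τ_P′ τ_Q′).withKQ κ_Q` has `Re μ < 0` or is the rotation mode. CERTIFIED
(p521952's certificate by congruence + monotonicity); MODELLED: MV-6N SYNTHETIC/CONSTRUCTION, lossless. No stability sentence. [folklore] -/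
theorem droopQV_allLoops_eig_re_neg_or_rotation (κ τP' τQ' κQ : Fin 3 → ℝ) (hκ : ∀ i, 0 < κ i) (hτP' : ∀ i, 0 < τP' i) (hτQ' : ∀ i, 0 < τQ' i)
    (hκQ : ∀ i, 0 < κQ i) (hle : ∀ i, κQ i ≤ 1 / 5) {μ : ℂ} {v : Fin 3 ⊕ (Fin 3 ⊕ Fin 3) → ℂ} (hv : v ≠ 0)
    (hJ : (((droopQV.toMicrogrid.withGainsTau κ τP' τQ').withKQ κQ).jacMatrix droopQV.angleOf droopQV.Vstar).map ((↑) : ℝ → ℂ) *ᵥ v = μ • v) :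
    μ.re < 0 ∨ (μ = 0 ∧ ∃ a : ℂ, v = fun k => a * ((DroopMicrogrid.rot k : ℝ) : ℂ)) := by
  have hg := fun i => droopQV.toMicrogrid_gains i
  have hVq : ∀ i : Fin 3, 0 < droopQV.V i := by decide +kernel
  have hr : rotVec = DroopMicrogrid.rot := rfl
  have hP := droopQV_hessQ_add_rankOne_posDef
  rw [hr] at hP
  refine droopQV.toMicrogrid.re_eig_neg_or_rotation_of_hessQ_allLoops κ τP' τQ' _ _ (fun i => ?_) (fun i => ?_) (fun i => ?_)
    droopQV_hessQ_transpose hP hκ hτP' hτQ' hκQ (fun i => ?_) hv hJ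
  · rw [(hg i).2.2.1]; norm_num [droopQV]
  · rw [(hg i).1]; norm_num [droopQV]
  · change (0 : ℝ) < (droopQV.V i : ℝ)
    exact_mod_cast hVq i
  · rw [(hg i).2.2.2.1]
    have h5 : ((droopQV.kQ i : ℚ) : ℝ) = 5⁻¹ := by norm_num [droopQV]
    rw [h5, inv_inv]
    exact (le_inv_comm₀ (by norm_num) (hκQ i)).2 (by simpa [one_div] using hle i)

/-! ### (append 2026-08-27, model-8 g4; rider «#141′ ALL-LOOPS-SIMPLE», lead g9 RULING 9ce (1) remedy (a)) Simplicity of the rotation zero for ALL loop parameters -/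

/-- The rest point of «DROOPQV-WSCC9» does not move with any of the `12` loop parameters. [folklore] -/
theorem droopQV_allLoops_field_eq_zero (κ τP' τQ' κQ : Fin 3 → ℝ) :
    ((WSCC9.droopQV.toMicrogrid.withGainsTau κ τP' τQ').withKQ κQ).field (WSCC9.droopQV.angleOf, 0, WSCC9.droopQV.Vstar) = 0 :=
  ((droopQV.toMicrogrid.withGainsTau κ τP' τQ').withKQ_field_eq_zero κQ
    ((droopQV.toMicrogrid.withGainsTau_isSteadyState_iff κ τP' τQ' droopQV.angleOf).2 droopQV.isSteadyState))

/-- **SIMPLE rotation zero for EVERY positive loop-parameter set («DROOPQV-WSCC9», `12` parameters)**: no complex `w` solves `jacMatrix (θ*, V*) w = r` for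
`(droopQV.toMicrogrid.withGainsTau κ τ_P′ τ_Q′).withKQ κ_Q` (structural: inherited symmetry; `DroopMicrogrid.no_jordan_chain_at_zero_of_hessQ_allLoops`).
CERTIFIED; MODELLED: MV-6N SYNTHETIC/CONSTRUCTION, lossless. No stability sentence. [folklore] -/
theorem droopQV_allLoops_no_jordan_chain_at_zero (κ τP' τQ' κQ : Fin 3 → ℝ) (hκ : ∀ i, 0 < κ i) (hτP' : ∀ i, 0 < τP' i)
    (hτQ' : ∀ i, 0 < τQ' i) (hκQ : ∀ i, 0 < κQ i) {w : Fin 3 ⊕ (Fin 3 ⊕ Fin 3) → ℂ}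
    (hw : (((WSCC9.droopQV.toMicrogrid.withGainsTau κ τP' τQ').withKQ κQ).jacMatrix WSCC9.droopQV.angleOf WSCC9.droopQV.Vstar).map ((↑) : ℝ → ℂ) *ᵥ w
      = fun k => ((DroopMicrogrid.rot k : ℝ) : ℂ)) : False := by
  have hg := fun i => droopQV.toMicrogrid_gains i
  have hVq : ∀ i : Fin 3, 0 < droopQV.V i := by decide +kernel
  refine droopQV.toMicrogrid.no_jordan_chain_at_zero_of_hessQ_allLoops κ τP' τQ' _ _ (fun i => ?_) (fun i => ?_) (fun i => ?_)
    droopQV_hessQ_transpose 0 hκ hτP' hτQ' hκQ hw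
  · rw [(hg i).2.2.1]; norm_num [droopQV]
  · rw [(hg i).1]; norm_num [droopQV]
  · change (0 : ℝ) < (droopQV.V i : ℝ)
    exact_mod_cast hVq i

end WSCC9

namespace NE39

/-- The rest point of «DROOPQV-NE39» does not move with the P–f gains. [folklore] -/
theorem droopQV_gains_field_eq_zero (κ : Fin 10 → ℝ) :
    (NE39.droopQV.toMicrogrid.withKP κ).field (NE39.droopQV.angleOf, 0, NE39.droopQV.Vstar) = 0 :=
  NE39.droopQV.toMicrogrid.withKP_field_eq_zero κ NE39.droopQV.isSteadyState

/-- **«DROOPQV-NE39» (30 states): Hurwitz on the rotation quotient for EVERY positive P–f gain vector.** For every `κ : Fin 10 → ℝ` with `κ_i > 0`,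
every complex eigenpair `(μ, v)` of the `30 × 30` Jacobian `jacMatrix (θ*, V*)` of `NE39.droopQV.toMicrogrid.withKP κ` has `Re μ < 0`, or `μ = 0` with
`v ∈ ℂ·r`. CERTIFIED (the shifted rounded-twin certificate of p529218, transported to all gains by congruence); MODELLED: MV-6N SYNTHETIC/CONSTRUCTION,
lossless, ten free gains. No stability sentence. [folklore] -/
theorem droopQV_gains_eig_re_neg_or_rotation (κ : Fin 10 → ℝ) (hκ : ∀ i, 0 < κ i) {μ : ℂ} {v : Fin 10 ⊕ (Fin 10 ⊕ Fin 10) → ℂ} (hv : v ≠ 0)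
    (hJ : ((NE39.droopQV.toMicrogrid.withKP κ).jacMatrix NE39.droopQV.angleOf NE39.droopQV.Vstar).map ((↑) : ℝ → ℂ) *ᵥ v = μ • v) :
    μ.re < 0 ∨ (μ = 0 ∧ ∃ a : ℂ, v = fun k => a * ((DroopMicrogrid.rot k : ℝ) : ℂ)) := by
  have hg := fun i => NE39.droopQV.toMicrogrid_gains i
  have hVq : ∀ i : Fin 10, 0 < NE39.droopQV.V i := by decide +kernel
  have hr : rotVec = DroopMicrogrid.rot := rfl
  have hP := droopQV_hessQ_add_rankOne_posDef
  rw [hr] at hP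
  refine NE39.droopQV.toMicrogrid.re_eig_neg_or_rotation_of_hessQ_withKP _ _ (fun i => ?_) (fun i => ?_) (fun i => ?_) (fun i => ?_)
    (fun i => ?_) (Matrix.ext fun a b => droopQV_hessQ_symm b a) hP hκ hv hJ
  · rw [(hg i).2.2.1]; norm_num [NE39.droopQV]
  · rw [(hg i).1]; norm_num [NE39.droopQV]
  · rw [(hg i).2.2.2.1]; norm_num [NE39.droopQV]
  · change (NE39.droopQV.V i : ℝ) ≠ 0
    exact_mod_cast (hVq i).ne'
  · rw [(hg i).2.2.2.1, (hg i).2.1]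
    have := hVq i
    simp only [DroopQVData.Vstar]
    norm_num [NE39.droopQV]
    positivity

/-- **SIMPLE rotation zero for every positive gain vector** («DROOPQV-NE39»). CERTIFIED (structural); MODELLED as above. No stability sentence. [folklore] -/
theorem droopQV_gains_no_jordan_chain_at_zero (κ : Fin 10 → ℝ) (hκ : ∀ i, 0 < κ i) {w : Fin 10 ⊕ (Fin 10 ⊕ Fin 10) → ℂ}
    (hw : ((NE39.droopQV.toMicrogrid.withKP κ).jacMatrix NE39.droopQV.angleOf NE39.droopQV.Vstar).map ((↑) : ℝ → ℂ) *ᵥ w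
      = fun k => ((DroopMicrogrid.rot k : ℝ) : ℂ)) : False := by
  have hg := fun i => NE39.droopQV.toMicrogrid_gains i
  have hVq : ∀ i : Fin 10, 0 < NE39.droopQV.V i := by decide +kernel
  refine NE39.droopQV.toMicrogrid.no_jordan_chain_at_zero_of_hessQ_withKP _ _ (fun i => ?_) (fun i => ?_) (fun i => ?_) (fun i => ?_)
    (fun i => ?_) (Matrix.ext fun a b => droopQV_hessQ_symm b a) 0 hκ hw
  · rw [(hg i).2.2.1]; norm_num [NE39.droopQV]
  · rw [(hg i).1]; norm_num [NE39.droopQV]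
  · rw [(hg i).2.2.2.1]; norm_num [NE39.droopQV]
  · change (NE39.droopQV.V i : ℝ) ≠ 0
    exact_mod_cast (hVq i).ne'
  · rw [(hg i).2.2.2.1, (hg i).2.1]
    have := hVq i
    simp only [DroopQVData.Vstar]
    norm_num [NE39.droopQV]
    positivity

/-- **«DROOPQV-NE39» (30 states): Hurwitz on the rotation quotient for EVERY positive frequency-loop parameter set** (`30` parameters: gains `κ`,
filter constants `τ_P′`, `τ_Q′` of the ten units; model `withGainsTau`). CERTIFIED (p529218's certificate by congruence); MODELLED: MV-6N
SYNTHETIC/CONSTRUCTION, lossless. No stability sentence. [folklore] -/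
theorem droopQV_loop_eig_re_neg_or_rotation (κ τP' τQ' : Fin 10 → ℝ) (hκ : ∀ i, 0 < κ i) (hτP' : ∀ i, 0 < τP' i) (hτQ' : ∀ i, 0 < τQ' i)
    {μ : ℂ} {v : Fin 10 ⊕ (Fin 10 ⊕ Fin 10) → ℂ} (hv : v ≠ 0)
    (hJ : ((NE39.droopQV.toMicrogrid.withGainsTau κ τP' τQ').jacMatrix NE39.droopQV.angleOf NE39.droopQV.Vstar).map ((↑) : ℝ → ℂ) *ᵥ v = μ • v) :
    μ.re < 0 ∨ (μ = 0 ∧ ∃ a : ℂ, v = fun k => a * ((DroopMicrogrid.rot k : ℝ) : ℂ)) := by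
  have hg := fun i => NE39.droopQV.toMicrogrid_gains i
  have hVq : ∀ i : Fin 10, 0 < NE39.droopQV.V i := by decide +kernel
  have hr : rotVec = DroopMicrogrid.rot := rfl
  have hP := droopQV_hessQ_add_rankOne_posDef
  rw [hr] at hP
  refine NE39.droopQV.toMicrogrid.re_eig_neg_or_rotation_of_hessQ_withGainsTau _ _ (fun i => ?_) (fun i => ?_) (fun i => ?_) (fun i => ?_)
    (fun i => ?_) (Matrix.ext fun a b => droopQV_hessQ_symm b a) hP hκ hτP' hτQ' hv hJ
  · rw [(hg i).2.2.1]; norm_num [NE39.droopQV]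
  · rw [(hg i).1]; norm_num [NE39.droopQV]
  · rw [(hg i).2.2.2.1]; norm_num [NE39.droopQV]
  · change (NE39.droopQV.V i : ℝ) ≠ 0
    exact_mod_cast (hVq i).ne'
  · rw [(hg i).2.2.2.1]
    have := hVq i
    simp only [DroopQVData.Vstar]
    norm_num [NE39.droopQV]
    positivity

/-- The rest point of «DROOPQV-NE39» does not move with the loop parameters. [folklore] -/
theorem droopQV_loop_field_eq_zero (κ τP' τQ' : Fin 10 → ℝ) :
    (NE39.droopQV.toMicrogrid.withGainsTau κ τP' τQ').field (NE39.droopQV.angleOf, 0, NE39.droopQV.Vstar) = 0 :=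
  NE39.droopQV.toMicrogrid.withGainsTau_field_eq_zero κ τP' τQ' NE39.droopQV.isSteadyState

/-- **«DROOPQV-NE39» (30 states): ALL `40` loop parameters.** For every positive `κ, τ_P′, τ_Q′` and every `κ_Q` with `0 < κ_Qi ≤ 1/5` (the printed Q–V gain), every complex
eigenpair of the `30 × 30` Jacobian at `(θ*, V*)` of `(NE39.droopQV.toMicrogrid.withGainsTau κ τ_P′ τ_Q′).withKQ κ_Q` has `Re μ < 0` or is the rotation mode. CERTIFIED
(p529218's certificate by congruence + monotonicity); MODELLED: MV-6N SYNTHETIC/CONSTRUCTION, lossless. No stability sentence. [folklore] -/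
theorem droopQV_allLoops_eig_re_neg_or_rotation (κ τP' τQ' κQ : Fin 10 → ℝ) (hκ : ∀ i, 0 < κ i) (hτP' : ∀ i, 0 < τP' i) (hτQ' : ∀ i, 0 < τQ' i)
    (hκQ : ∀ i, 0 < κQ i) (hle : ∀ i, κQ i ≤ 1 / 5) {μ : ℂ} {v : Fin 10 ⊕ (Fin 10 ⊕ Fin 10) → ℂ} (hv : v ≠ 0)
    (hJ : (((NE39.droopQV.toMicrogrid.withGainsTau κ τP' τQ').withKQ κQ).jacMatrix NE39.droopQV.angleOf NE39.droopQV.Vstar).map ((↑) : ℝ → ℂ) *ᵥ v = μ • v) :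
    μ.re < 0 ∨ (μ = 0 ∧ ∃ a : ℂ, v = fun k => a * ((DroopMicrogrid.rot k : ℝ) : ℂ)) := by
  have hg := fun i => NE39.droopQV.toMicrogrid_gains i
  have hVq : ∀ i : Fin 10, 0 < NE39.droopQV.V i := by decide +kernel
  have hr : rotVec = DroopMicrogrid.rot := rfl
  have hP := droopQV_hessQ_add_rankOne_posDef
  rw [hr] at hP
  refine NE39.droopQV.toMicrogrid.re_eig_neg_or_rotation_of_hessQ_allLoops κ τP' τQ' _ _ (fun i => ?_) (fun i => ?_) (fun i => ?_)
    (Matrix.ext fun a b => droopQV_hessQ_symm b a) hP hκ hτP' hτQ' hκQ (fun i => ?_) hv hJ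
  · rw [(hg i).2.2.1]; norm_num [NE39.droopQV]
  · rw [(hg i).1]; norm_num [NE39.droopQV]
  · change (0 : ℝ) < (NE39.droopQV.V i : ℝ)
    exact_mod_cast hVq i
  · rw [(hg i).2.2.2.1]
    have h5 : ((NE39.droopQV.kQ i : ℚ) : ℝ) = 5⁻¹ := by norm_num [NE39.droopQV]
    rw [h5, inv_inv]
    exact (le_inv_comm₀ (by norm_num) (hκQ i)).2 (by simpa [one_div] using hle i)

/-! ### (append 2026-08-27, model-8 g4; rider «#141′ ALL-LOOPS-SIMPLE») Simplicity of the rotation zero for ALL loop parameters -/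

/-- The rest point of «DROOPQV-NE39» does not move with any of the `40` loop parameters. [folklore] -/
theorem droopQV_allLoops_field_eq_zero (κ τP' τQ' κQ : Fin 10 → ℝ) :
    ((NE39.droopQV.toMicrogrid.withGainsTau κ τP' τQ').withKQ κQ).field (NE39.droopQV.angleOf, 0, NE39.droopQV.Vstar) = 0 :=
  ((NE39.droopQV.toMicrogrid.withGainsTau κ τP' τQ').withKQ_field_eq_zero κQ
    ((NE39.droopQV.toMicrogrid.withGainsTau_isSteadyState_iff κ τP' τQ' NE39.droopQV.angleOf).2 NE39.droopQV.isSteadyState))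

/-- **SIMPLE rotation zero for EVERY positive loop-parameter set («DROOPQV-NE39», 30 states, `40` parameters)**: no complex `w` solves
`jacMatrix (θ*, V*) w = r` for `(NE39.droopQV.toMicrogrid.withGainsTau κ τ_P′ τ_Q′).withKQ κ_Q`. CERTIFIED (structural); MODELLED: MV-6N
SYNTHETIC/CONSTRUCTION, lossless. No stability sentence. [folklore] -/
theorem droopQV_allLoops_no_jordan_chain_at_zero (κ τP' τQ' κQ : Fin 10 → ℝ) (hκ : ∀ i, 0 < κ i) (hτP' : ∀ i, 0 < τP' i)
    (hτQ' : ∀ i, 0 < τQ' i) (hκQ : ∀ i, 0 < κQ i) {w : Fin 10 ⊕ (Fin 10 ⊕ Fin 10) → ℂ}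
    (hw : (((NE39.droopQV.toMicrogrid.withGainsTau κ τP' τQ').withKQ κQ).jacMatrix NE39.droopQV.angleOf NE39.droopQV.Vstar).map ((↑) : ℝ → ℂ) *ᵥ w
      = fun k => ((DroopMicrogrid.rot k : ℝ) : ℂ)) : False := by
  have hg := fun i => NE39.droopQV.toMicrogrid_gains i
  have hVq : ∀ i : Fin 10, 0 < NE39.droopQV.V i := by decide +kernel
  refine NE39.droopQV.toMicrogrid.no_jordan_chain_at_zero_of_hessQ_allLoops κ τP' τQ' _ _ (fun i => ?_) (fun i => ?_) (fun i => ?_)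
    (Matrix.ext fun a b => droopQV_hessQ_symm b a) 0 hκ hτP' hτQ' hκQ hw
  · rw [(hg i).2.2.1]; norm_num [NE39.droopQV]
  · rw [(hg i).1]; norm_num [NE39.droopQV]
  · change (0 : ℝ) < (NE39.droopQV.V i : ℝ)
    exact_mod_cast hVq i

end NE39

end Summit.Ventures.GridStability.Models

end
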